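import Mathlib.Analysis.Asymptotics.SpecificAsymptotics
import Literature.Probability.Percolation.OneArmOSSSDiffIneqZd
import Literature.Probability.Percolation.CorrelationLengthDKTProofs
import Literature.Probability.LatticeModels.LatticeGraphProofs
import Summits.CriticalPhenomena.PercolationContinuityZ3.Theorems.PercNearOneGluingNoHeavyQuantThetaOneArmModulus
import HarnessLib

/-!
# QUANT lane (p4 gen 13, METHOD: differential inequalities near `p_c`): FINITE-SIZE SHARPNESS FROM THE CRITICAL
# PROFILE — the OSSS one-arm differential inequality integrated below `p_c`

builds on p205010 (kernel theorem, internal audit signed; external expert review pending).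
Status sentence for p205010: "θ(p_c) = 0 on ℤ^d, all d ≥ 2 — kernel-verified (Lean 4/Mathlib, standard
axioms); internal adversarial audit SIGNED 2026-08-20 04:29Z; external expert review pending."

Seat `prim-quant-p4` (gen 13), `--supports stmt-CriticalPhenomena-4575`; pure proofs, no definitions.  Inputs: the
kernel OSSS one-arm differential inequality `n θ_n(1−θ_n) ≤ 4p(1−p) S_n θ_n'` of
`Literature/Probability/Percolation/OneArmOSSSDiffIneqZd.lean` (Duminil-Copin–Raoufi–Tassion 2019, Lemma 3.2 /
Duminil-Copin 2018, Lemma 3.8; this generation), Russo, and — only in §3 — p205010.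

* §1 `thetaN_le_thetaN_mul_exp` — for `0 < α ≤ β < 1`, every `d ≥ 1`, `n ≥ 0`:
  **`θ_n(α) ≤ θ_n(β) · exp(−(β − α) · n(1 − θ_n(β)) / S_n(β))`**, `S_n(β) = Σ_{k<n} θ_k(β)` — the finite-size form
  of sharpness driven by the one-arm PROFILE at the upper parameter (Menshikov's (5.25) in Grimmett 1999 has the
  same shape, `g_α(n) ≤ g_β(n) exp(−(β−α)(n/Σ_{i≤n} g_β(i) − 1))`; here by `r ↦ θ_n(r)e^{−Kr}` non-decreasing).
* §2 at `β = p_c(ℤ^d)`, `d ≥ 2`: **`π_n(p_c − t) ≤ π_n(p_c) · exp(−t (1−p_c)^{2d} · n / S_n(p_c))`** (`n ≥ 1`).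
* §3 (p205010) `S_n(p_c)/n → 0`, hence `n/S_n(p_c) → ∞` and for every fixed `t ∈ (0, p_c)` the factor
  `exp(−t(1−p_c)^{2d} n/S_n(p_c)) → 0`: the subcritical one-arm probability at scale `n` is an explicit `o(1)` multiple
  of the critical one, with ONE profile function `n/S_n(p_c)` serving every `t`; and the critical log-derivative
  `θ_n'(p_c)/θ_n(p_c) ≥ (1−p_c)^{2d}/(4p_c(1−p_c)) · n/S_n(p_c) → ∞`.
* §4 dictionary: `S_n(p_c) ≤ B n^{1−c}` (e.g. from (T1) `π_k(p_c) ≤ C k^{−c}`, `c < 1`) ⇒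
  `π_n(p_c − t) ≤ π_n(p_c) exp(−t (1−p_c)^{2d} n^{c}/B)`.

HONEST STATUS.  No rate at `p_c` and nothing for (T1)/(T2): every statement is explicit modulo the critical profile
`(π_k(p_c))_k`, exactly like the lane's modulus of continuity.  §3 is qualitatively implied by exponential decay
below `p_c` (tree, Duminil-Copin–Tassion) together with the polynomial lower bound on `π_n(p_c)`; its content is the
uniform explicit form.  The exponent consequences of §4 under power-law hypotheses ("`ν ≤ 1` if `ρ < 1`, `1 ≤ ν ≤ ρ`
if `ρ > 1`") are Grimmett 1999, §10.2 notes, p. 291: "certain inequalities of debatable interest may be obtained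
directly from inequality (5.22)" — recorded here as finite-size statements only, for the lane's table of
transfers; mean-field check: NOT sharp (window `1/n` against the true `n^{−2}` in high `d`).
References: H. Duminil-Copin, A. Raoufi, V. Tassion, Ann. of Math. 189 (2019) §3; H. Duminil-Copin,
arXiv:1810.03384, Lemma 3.8; M. V. Menshikov, Soviet Math. Dokl. 33 (1986); G. Grimmett, *Percolation* (1999),
(5.22)–(5.25) and p. 291.
-/

noncomputable section

namespace Summit.CriticalPhenomena.PercolationContinuityZ3.Theorems.FiniteSizeSharpness

open MeasureTheory Filter Topology Finset
open Literature.Probability.Percolation Literature.Probability.LatticeModels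
open Literature.Probability.Percolation.DCT16 Literature.Probability.Percolation.OneArmOSSS

variable {d : ℕ}

/-! ### §0. Elementary facts on `θ_n` -/

/-- `θ_0(p) = 1`: the origin lies on `∂Λ_0 = Λ_0 = {0}` (for `d ≥ 1`). -/
theorem real_siteToBoundary_zero (hd : 1 ≤ d) (p : unitInterval) :
    (bondPercolation (zdGraph d) p).real (siteToBoundary d 0) = 1 := by
  have h0 : (0 : Site d) ∈ innerBoundary (zdGraph d) (box d 0) := by
    rw [mem_innerBoundary_iff]
    refine ⟨zero_mem_box d 0, 0 + Pi.single ⟨0, hd⟩ 1, fun h => ?_,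
      (zdGraph_adj_iff _ _).2 ⟨⟨0, hd⟩, Or.inl rfl⟩⟩
    have := (mem_box.1 h ⟨0, hd⟩).2
    simp at this
  have huniv : siteToBoundary d 0 = Set.univ := by
    ext ω
    simp only [Set.mem_univ, iff_true, mem_siteToBoundary_iff]
    exact ⟨0, h0, PathIn.refl (zero_mem_box d 0)⟩
  rw [huniv, probReal_univ]

/-- `θ_0(q) = 1` for the real-parameter function. -/
theorem thetaN_zero (hd : 1 ≤ d) (q : ℝ) : thetaN d 0 q = 1 :=
  real_siteToBoundary_zero hd _

/-- `S_n(q) = Σ_{k<n} θ_k(q) ≥ 1` for `n ≥ 1` (the term `θ_0 = 1`). -/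
theorem one_le_sum_thetaN (hd : 1 ≤ d) {n : ℕ} (hn : 1 ≤ n) (q : ℝ) :
    1 ≤ ∑ k ∈ Finset.range n, thetaN d k q := by
  calc (1 : ℝ) = ∑ k ∈ Finset.range 1, thetaN d k q := by simp [thetaN_zero hd]
    _ ≤ ∑ k ∈ Finset.range n, thetaN d k q :=
        Finset.sum_le_sum_of_subset_of_nonneg (Finset.range_subset_range.2 hn)
          fun k _ _ => (thetaN_mem_Icc d k q).1

/-- `(1 − p)^{2d} ≤ 1 − θ_n(p)` for `n ≥ 1`: with probability `(1−p)^{2d}` all edges at the origin are closed, and then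
`0 ↮ ∂Λ_1`, while `θ_n ≤ θ_1`. -/
theorem pow_le_one_sub_thetaN {n : ℕ} (hn : 1 ≤ n) (p : unitInterval) :
    (1 - (p : ℝ)) ^ (2 * d) ≤ 1 - (bondPercolation (zdGraph d) p).real (siteToBoundary d n) := by
  classical
  set K : Finset (Sym2 (Site d)) := ((zdGraph d).neighborFinset 0).image fun u => s((0 : Site d), u) with hK
  have hKcard : K.card = 2 * d := by
    rw [hK, Finset.card_image_of_injective _ fun u v h => Sym2.congr_right.1 h]
    exact card_neighborFinset_zdGraph_holds (0 : Site d)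
  have hle : (bondPercolation (zdGraph d) p).real (siteToBoundary d 1) ≤
      (bondPercolation (zdGraph d) p).real {ω | ∀ e ∈ K, e ∉ ω}ᶜ := by
    refine real_mono_of_forall_subset_edgeSet (zdGraph d) p fun ω hω h => ?_
    rw [Set.mem_compl_iff, Set.mem_setOf_eq]
    intro hcl
    refine not_mem_siteToBoundary_one hω (fun u hu => hcl _ ?_) h
    rw [hK, Finset.mem_image]
    exact ⟨u, hu, rfl⟩
  rw [measureReal_compl (measurableSet_forall_notMem K), probReal_univ] at hle
  have hge := le_bondPercolation_real_forall_notMem (zdGraph d) p K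
  rw [hKcard] at hge
  have hmono := real_siteToBoundary_antitone (d := d) p hn
  linarith

/-! ### §1. The integrated inequality between two parameters -/

/-- Grönwall step (calculus): if `f` is continuous on `[α, β]`, differentiable on `(α, β)` with `K·f ≤ f'` there,
then `f(α) ≤ f(β)·e^{−(β−α)K}` (the function `r ↦ f(r) e^{−Kr}` is non-decreasing). -/
theorem le_mul_exp_of_mul_le_deriv {f : ℝ → ℝ} {α β K : ℝ} (hαβ : α ≤ β) (hf : ContinuousOn f (Set.Icc α β))
    (hd : ∀ x ∈ Set.Ioo α β, DifferentiableAt ℝ f x) (hK : ∀ x ∈ Set.Ioo α β, K * f x ≤ deriv f x) :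
    f α ≤ f β * Real.exp (-((β - α) * K)) := by
  have hmono : MonotoneOn (fun r => f r * Real.exp (-K * r)) (Set.Icc α β) := by
    refine monotoneOn_of_deriv_nonneg (convex_Icc α β) (hf.mul (by fun_prop)) ?_ ?_
    · rw [interior_Icc]
      intro x hx
      exact ((hd x hx).mul (by fun_prop)).differentiableWithinAt
    · rw [interior_Icc]
      intro x hx
      have hE : HasDerivAt (fun r => Real.exp (-K * r)) (Real.exp (-K * x) * (-K)) x := by
        have := ((hasDerivAt_id x).const_mul (-K)).exp
        simpa [mul_comm] using this
      have hfg : (fun r => f r * Real.exp (-K * r)) = f * fun r => Real.exp (-K * r) := rfl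
      rw [hfg, ((hd x hx).hasDerivAt.mul hE).deriv]
      have : deriv f x * Real.exp (-K * x) + f x * (Real.exp (-K * x) * -K)
          = Real.exp (-K * x) * (deriv f x - K * f x) := by ring
      rw [this]
      exact mul_nonneg (Real.exp_pos _).le (by linarith [hK x hx])
  have h := hmono ⟨le_rfl, hαβ⟩ ⟨hαβ, le_rfl⟩ hαβ
  simp only at h
  have heq : f β * Real.exp (-((β - α) * K)) = f β * Real.exp (-K * β) * Real.exp (K * α) := by
    rw [mul_assoc, ← Real.exp_add]; congr 1; ring
  have h2 : f α = f α * Real.exp (-K * α) * Real.exp (K * α) := by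
    rw [mul_assoc, ← Real.exp_add]; simp
  rw [heq, h2]
  exact mul_le_mul_of_nonneg_right h (Real.exp_pos _).le

/-- The OSSS inequality on `[α, β] ⊆ (0,1)` in Grönwall form: for `x ∈ (α, β)`,
`K · θ_n(x) ≤ θ_n'(x)` with `K = n(1 − θ_n(β))/S_n(β)` (use `4x(1−x) ≤ 1`, `θ_n(x) ≤ θ_n(β)`, `S_n(x) ≤ S_n(β)`). -/
theorem const_mul_thetaN_le_deriv (hd : 1 ≤ d) (n : ℕ) {α β x : ℝ} (hα : 0 < α) (hβ : β < 1)
    (hx : x ∈ Set.Ioo α β) :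
    (n : ℝ) * (1 - thetaN d n β) / (∑ k ∈ Finset.range n, thetaN d k β) * thetaN d n x
      ≤ deriv (thetaN d n) x := by
  have hx' : x ∈ Set.Ioo (0 : ℝ) 1 := ⟨hα.trans hx.1, hx.2.trans hβ⟩
  obtain ⟨D, hD, hD0, hineq⟩ := oneArm_hasDerivAt_ge hd n hx'
  rw [hD.deriv]
  have hS0 : 0 ≤ ∑ k ∈ Finset.range n, thetaN d k β := Finset.sum_nonneg fun k _ => (thetaN_mem_Icc d k β).1
  have hSx : ∑ k ∈ Finset.range n, thetaN d k x ≤ ∑ k ∈ Finset.range n, thetaN d k β :=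
    Finset.sum_le_sum fun k _ => DKT20.thetaN_mono d k hx.2.le
  have hSx0 : 0 ≤ ∑ k ∈ Finset.range n, thetaN d k x :=
    Finset.sum_nonneg fun k _ => (thetaN_mem_Icc d k x).1
  have hθx : thetaN d n x ≤ thetaN d n β := DKT20.thetaN_mono d n hx.2.le
  have hθx0 : 0 ≤ thetaN d n x := (thetaN_mem_Icc d n x).1
  have h4 : 4 * (x * (1 - x)) ≤ 1 := by nlinarith [sq_nonneg (2 * x - 1)]
  -- `n θ(x) (1−θ(β)) ≤ S_n(β) D`
  have hSD : 0 ≤ (∑ k ∈ Finset.range n, thetaN d k x) * D := mul_nonneg hSx0 hD0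
  have h1 : (n : ℝ) * (thetaN d n x * (1 - thetaN d n x)) ≤ (∑ k ∈ Finset.range n, thetaN d k x) * D := by
    calc (n : ℝ) * (thetaN d n x * (1 - thetaN d n x))
        ≤ 4 * (x * (1 - x)) * (∑ k ∈ Finset.range n, thetaN d k x) * D := hineq
      _ = (4 * (x * (1 - x))) * ((∑ k ∈ Finset.range n, thetaN d k x) * D) := by ring
      _ ≤ 1 * ((∑ k ∈ Finset.range n, thetaN d k x) * D) := mul_le_mul_of_nonneg_right h4 hSD
      _ = _ := by ring
  have hkey : (n : ℝ) * (1 - thetaN d n β) * thetaN d n x ≤ (∑ k ∈ Finset.range n, thetaN d k β) * D := by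
    have h2 : (n : ℝ) * (1 - thetaN d n β) * thetaN d n x ≤ (n : ℝ) * (thetaN d n x * (1 - thetaN d n x)) := by
      have : (1 - thetaN d n β) ≤ (1 - thetaN d n x) := by linarith
      calc (n : ℝ) * (1 - thetaN d n β) * thetaN d n x = ((n : ℝ) * thetaN d n x) * (1 - thetaN d n β) := by ring
        _ ≤ ((n : ℝ) * thetaN d n x) * (1 - thetaN d n x) :=
            mul_le_mul_of_nonneg_left this (mul_nonneg (Nat.cast_nonneg n) hθx0)
        _ = _ := by ring
    exact h2.trans (h1.trans (mul_le_mul_of_nonneg_right hSx hD0))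
  rcases hS0.eq_or_lt with hS00 | hSpos
  · rw [← hS00, div_zero, zero_mul]; exact hD0
  · rw [div_mul_eq_mul_div, div_le_iff₀ hSpos]
    calc (n : ℝ) * (1 - thetaN d n β) * thetaN d n x ≤ (∑ k ∈ Finset.range n, thetaN d k β) * D := hkey
      _ = D * ∑ k ∈ Finset.range n, thetaN d k β := by ring

/-- **Finite-size sharpness from the profile at the upper parameter** (every `d ≥ 1`, `n ≥ 0`, `0 < α ≤ β < 1`):
`θ_n(α) ≤ θ_n(β) · exp(−(β − α) · n (1 − θ_n(β)) / S_n(β))`, `S_n(β) = Σ_{k<n} θ_k(β)`.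
Proof: on `[α, β]` the OSSS inequality gives `θ_n' ≥ K θ_n` with `K = n(1−θ_n(β))/S_n(β)`, so
`r ↦ θ_n(r) e^{−Kr}` is non-decreasing.  The shape is Menshikov's (Grimmett 1999 (5.25)); the constant and the
route are Duminil-Copin–Raoufi–Tassion's. -/
theorem thetaN_le_thetaN_mul_exp (hd : 1 ≤ d) (n : ℕ) {α β : ℝ} (hα : 0 < α) (hαβ : α ≤ β) (hβ : β < 1) :
    thetaN d n α ≤ thetaN d n β *
      Real.exp (-((β - α) * ((n : ℝ) * (1 - thetaN d n β) / ∑ k ∈ Finset.range n, thetaN d k β))) :=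
  le_mul_exp_of_mul_le_deriv hαβ (continuous_thetaN d n).continuousOn
    (fun _ hx => differentiableAt_thetaN n ⟨hα.trans hx.1, hx.2.trans hβ⟩)
    (fun _ hx => const_mul_thetaN_le_deriv hd n hα hβ hx)

/-! ### §2. At the critical point -/

/-- `0 < p_c(ℤ^d) < 1` for `d ≥ 2` (tree), as real numbers. -/
theorem criticalProbI_mem_Ioo (hd : 2 ≤ d) : (criticalProbI d : ℝ) ∈ Set.Ioo (0 : ℝ) 1 := by
  refine ⟨?_, ?_⟩
  · rw [coe_criticalProbI]; exact criticalProb_zd_pos d (by omega)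
  · rw [coe_criticalProbI]; exact criticalProb_zd_lt_one hd

/-- `θ_n` at the real number `p_c` is the lane's `π_{p_c}(n) = oneArmProb d p_c n`. -/
theorem thetaN_criticalProbI (n : ℕ) : thetaN d n (criticalProbI d) = oneArmProb d (criticalProbI d) n := by
  rw [thetaN_coe]; rfl

/-- **Subcritical one-arm from the critical profile** (every `d ≥ 2`, `n ≥ 0`, `0 < t < p_c`):
`π_n(p_c − t) ≤ π_n(p_c) · exp(−t · n(1 − π_n(p_c)) / S_n(p_c))`, `S_n(p_c) = Σ_{k<n} π_k(p_c)`.  No rate: explicit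
modulo the critical profile.  builds on p205010? NO — this statement does not use it. -/
theorem thetaN_subcritical_le (hd : 2 ≤ d) (n : ℕ) {t : ℝ} (ht0 : 0 < t) (ht : t < criticalProbI d) :
    thetaN d n (criticalProbI d - t) ≤ thetaN d n (criticalProbI d) *
      Real.exp (-(t * ((n : ℝ) * (1 - thetaN d n (criticalProbI d)) /
        ∑ k ∈ Finset.range n, thetaN d k (criticalProbI d)))) := by
  have hpc := criticalProbI_mem_Ioo hd
  have h := thetaN_le_thetaN_mul_exp (by omega : 1 ≤ d) n (α := criticalProbI d - t) (β := criticalProbI d)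
    (by linarith) (by linarith) hpc.2
  rwa [show (criticalProbI d : ℝ) - (criticalProbI d - t) = t by ring] at h

/-- The same with the `n`-free constant `(1 − p_c)^{2d} ≤ 1 − π_n(p_c)` (`n ≥ 1`):
**`π_n(p_c − t) ≤ π_n(p_c) · exp(−t (1−p_c)^{2d} · n / S_n(p_c))`**. -/
theorem thetaN_subcritical_le' (hd : 2 ≤ d) {n : ℕ} (hn : 1 ≤ n) {t : ℝ} (ht0 : 0 < t) (ht : t < criticalProbI d) :
    thetaN d n (criticalProbI d - t) ≤ thetaN d n (criticalProbI d) *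
      Real.exp (-(t * (1 - (criticalProbI d : ℝ)) ^ (2 * d) *
        ((n : ℝ) / ∑ k ∈ Finset.range n, thetaN d k (criticalProbI d)))) := by
  refine (thetaN_subcritical_le hd n ht0 ht).trans (mul_le_mul_of_nonneg_left ?_ (thetaN_mem_Icc d n _).1)
  rw [Real.exp_le_exp, neg_le_neg_iff]
  have hS : 1 ≤ ∑ k ∈ Finset.range n, thetaN d k (criticalProbI d) := one_le_sum_thetaN (by omega) hn _
  have hc : (1 - (criticalProbI d : ℝ)) ^ (2 * d) ≤ 1 - thetaN d n (criticalProbI d) := by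
    rw [thetaN_coe]; exact pow_le_one_sub_thetaN hn _
  have hnS : 0 ≤ (n : ℝ) / ∑ k ∈ Finset.range n, thetaN d k (criticalProbI d) :=
    div_nonneg (Nat.cast_nonneg n) (by linarith)
  calc t * (1 - (criticalProbI d : ℝ)) ^ (2 * d) * ((n : ℝ) / ∑ k ∈ Finset.range n, thetaN d k (criticalProbI d))
      = t * ((1 - (criticalProbI d : ℝ)) ^ (2 * d) * ((n : ℝ) / ∑ k ∈ Finset.range n, thetaN d k (criticalProbI d))) := by
        ring
    _ ≤ t * ((1 - thetaN d n (criticalProbI d)) * ((n : ℝ) / ∑ k ∈ Finset.range n, thetaN d k (criticalProbI d))) :=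
        mul_le_mul_of_nonneg_left (mul_le_mul_of_nonneg_right hc hnS) ht0.le
    _ = t * ((n : ℝ) * (1 - thetaN d n (criticalProbI d)) / ∑ k ∈ Finset.range n, thetaN d k (criticalProbI d)) := by
        ring

/-- **The critical log-derivative** (every `d ≥ 2`, `n ≥ 1`): `θ_n'(p_c) ≥ (1−p_c)^{2d}/(4p_c(1−p_c)) · (n/S_n(p_c)) · π_n(p_c)`. -/
theorem deriv_thetaN_criticalProbI_ge (hd : 2 ≤ d) {n : ℕ} (hn : 1 ≤ n) :
    (1 - (criticalProbI d : ℝ)) ^ (2 * d) / (4 * ((criticalProbI d : ℝ) * (1 - criticalProbI d))) *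
        ((n : ℝ) / ∑ k ∈ Finset.range n, thetaN d k (criticalProbI d)) * thetaN d n (criticalProbI d)
      ≤ deriv (thetaN d n) (criticalProbI d) := by
  have hpc := criticalProbI_mem_Ioo hd
  have h := oneArm_deriv_ge (by omega : 1 ≤ d) n hpc
  have hS : 1 ≤ ∑ k ∈ Finset.range n, thetaN d k (criticalProbI d) := one_le_sum_thetaN (by omega) hn _
  have hc : (1 - (criticalProbI d : ℝ)) ^ (2 * d) ≤ 1 - thetaN d n (criticalProbI d) := by
    rw [thetaN_coe]; exact pow_le_one_sub_thetaN hn _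
  have hθ0 : 0 ≤ thetaN d n (criticalProbI d) := (thetaN_mem_Icc d n _).1
  have hpp : 0 < 4 * ((criticalProbI d : ℝ) * (1 - criticalProbI d)) := by nlinarith [hpc.1, hpc.2]
  set S := ∑ k ∈ Finset.range n, thetaN d k (criticalProbI d) with hSdef
  set θ := thetaN d n (criticalProbI d)
  set D := deriv (thetaN d n) (criticalProbI d)
  have hD0 : 0 ≤ D := deriv_thetaN_nonneg (by omega) n hpc
  -- from `n θ (1−θ) ≤ 4p(1−p) S D`
  have h1 : (n : ℝ) * θ * (1 - (criticalProbI d : ℝ)) ^ (2 * d) ≤ 4 * ((criticalProbI d : ℝ) * (1 - criticalProbI d)) * S * D := by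
    calc (n : ℝ) * θ * (1 - (criticalProbI d : ℝ)) ^ (2 * d) ≤ (n : ℝ) * θ * (1 - θ) :=
          mul_le_mul_of_nonneg_left hc (mul_nonneg (Nat.cast_nonneg n) hθ0)
      _ = (n : ℝ) * (θ * (1 - θ)) := by ring
      _ ≤ _ := h
  have hSpos : 0 < S := by linarith
  have key : (1 - (criticalProbI d : ℝ)) ^ (2 * d) / (4 * ((criticalProbI d : ℝ) * (1 - criticalProbI d))) *
        ((n : ℝ) / S) * θ
      = ((n : ℝ) * θ * (1 - (criticalProbI d : ℝ)) ^ (2 * d)) / ((4 * ((criticalProbI d : ℝ) * (1 - criticalProbI d))) * S) := by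
    rw [div_mul_div_comm, div_mul_eq_mul_div]
    ring
  rw [key, div_le_iff₀ (mul_pos hpp hSpos)]
  calc (n : ℝ) * θ * (1 - (criticalProbI d : ℝ)) ^ (2 * d) ≤ 4 * ((criticalProbI d : ℝ) * (1 - criticalProbI d)) * S * D := h1
    _ = D * (4 * ((criticalProbI d : ℝ) * (1 - criticalProbI d)) * S) := by ring

/-! ### §3. With `θ(p_c) = 0` (p205010): the profile function `n/S_n(p_c)` diverges -/

/-- **`π_n(p_c) → 0`** (every `d ≥ 2`): `θ(p_c) = inf_n π_n(p_c) = 0`.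
builds on p205010 (kernel theorem, internal audit signed; external expert review pending). -/
theorem tendsto_thetaN_criticalProbI (hd : 2 ≤ d) :
    Tendsto (fun n => thetaN d n (criticalProbI d)) atTop (𝓝 0) := by
  rw [tendsto_order]
  refine ⟨fun a ha => Eventually.of_forall fun n => ha.trans_le (thetaN_mem_Icc d n _).1, fun b hb => ?_⟩
  obtain ⟨N, hN⟩ := ThetaModulus.exists_oneArmProb_critical_lt (d := d) hd hb
  refine eventually_atTop.2 ⟨N, fun n hn => lt_of_le_of_lt ?_ hN⟩
  rw [thetaN_criticalProbI]
  exact real_siteToBoundary_antitone (criticalProbI d) hn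

/-- **`S_n(p_c)/n → 0`** (Cesàro).  builds on p205010 (kernel theorem, internal audit signed; external expert review pending). -/
theorem tendsto_sum_thetaN_div (hd : 2 ≤ d) :
    Tendsto (fun n : ℕ => (∑ k ∈ Finset.range n, thetaN d k (criticalProbI d)) / n) atTop (𝓝 0) := by
  have h := (tendsto_thetaN_criticalProbI hd).cesaro
  refine h.congr fun n => ?_
  rw [inv_mul_eq_div]

/-- **`n/S_n(p_c) → ∞`**.  builds on p205010 (kernel theorem, internal audit signed; external expert review pending). -/
theorem tendsto_div_sum_thetaN (hd : 2 ≤ d) :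
    Tendsto (fun n : ℕ => (n : ℝ) / ∑ k ∈ Finset.range n, thetaN d k (criticalProbI d)) atTop atTop := by
  have h1 : Tendsto (fun n : ℕ => (∑ k ∈ Finset.range n, thetaN d k (criticalProbI d)) / n)
      atTop (𝓝[>] 0) := by
    refine tendsto_nhdsWithin_of_tendsto_nhds_of_eventually_within _ (tendsto_sum_thetaN_div hd) ?_
    refine eventually_atTop.2 ⟨1, fun n hn => ?_⟩
    exact div_pos (lt_of_lt_of_le zero_lt_one (one_le_sum_thetaN (by omega) hn _)) (by exact_mod_cast hn)
  have h2 := tendsto_inv_nhdsGT_zero.comp h1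
  refine h2.congr fun n => ?_
  simp [inv_div]

/-- **The explicit subcritical/critical ratio tends to `0`**: for fixed `t > 0`,
`exp(−t (1−p_c)^{2d} · n/S_n(p_c)) → 0`; together with `thetaN_subcritical_le'` this says
`π_n(p_c − t) ≤ ε_t(n) π_n(p_c)` with an EXPLICIT `ε_t(n) → 0` built from the critical profile alone.
builds on p205010 (kernel theorem, internal audit signed; external expert review pending). -/
theorem tendsto_exp_factor (hd : 2 ≤ d) {t : ℝ} (ht0 : 0 < t) :
    Tendsto (fun n : ℕ => Real.exp (-(t * (1 - (criticalProbI d : ℝ)) ^ (2 * d) *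
      ((n : ℝ) / ∑ k ∈ Finset.range n, thetaN d k (criticalProbI d))))) atTop (𝓝 0) := by
  have hpc := criticalProbI_mem_Ioo hd
  have hc : 0 < t * (1 - (criticalProbI d : ℝ)) ^ (2 * d) := mul_pos ht0 (pow_pos (by linarith [hpc.2]) _)
  refine Real.tendsto_exp_atBot.comp ?_
  rw [tendsto_neg_atBot_iff]
  exact (tendsto_div_sum_thetaN hd).const_mul_atTop hc

/-- **The critical log-derivative diverges**: `θ_n'(p_c) ≥ c_d · (n/S_n(p_c)) · π_n(p_c)` with `n/S_n(p_c) → ∞`, so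
the lower bound on `θ_n'(p_c)/π_n(p_c)` tends to `∞` (every `d ≥ 2`).
builds on p205010 (kernel theorem, internal audit signed; external expert review pending). -/
theorem tendsto_logDeriv_lowerBound (hd : 2 ≤ d) :
    Tendsto (fun n : ℕ => (1 - (criticalProbI d : ℝ)) ^ (2 * d) / (4 * ((criticalProbI d : ℝ) * (1 - criticalProbI d))) *
      ((n : ℝ) / ∑ k ∈ Finset.range n, thetaN d k (criticalProbI d))) atTop atTop := by
  have hpc := criticalProbI_mem_Ioo hd
  have hc : 0 < (1 - (criticalProbI d : ℝ)) ^ (2 * d) / (4 * ((criticalProbI d : ℝ) * (1 - criticalProbI d))) :=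
    div_pos (pow_pos (by linarith [hpc.2]) _) (by nlinarith [hpc.1, hpc.2])
  exact (tendsto_div_sum_thetaN hd).const_mul_atTop hc

/-! ### §4. Dictionary: a bound on the critical profile sum gives an explicit subcritical decay -/

/-- **Profile-sum dictionary**: if `S_n(p_c) ≤ B · n^{1−c}` for some `n ≥ 1` (`B > 0`), then
`π_n(p_c − t) ≤ π_n(p_c) · exp(−t (1−p_c)^{2d} n^{c} / B)` for `0 < t < p_c`.  Under (T1) `π_k(p_c) ≤ C k^{−c}`
(`0 < c < 1`) the hypothesis holds with `B = 1 + C/(1−c)` for all `n ≥ 1`; the exponent reading "`ν ≤ 1/c`-type"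
is Grimmett 1999 p. 291's inequality "of debatable interest" — finite-size form only, no claim beyond it. -/
theorem thetaN_subcritical_le_of_sum_le (hd : 2 ≤ d) {n : ℕ} (hn : 1 ≤ n) {c B : ℝ} (hB : 0 < B)
    (hS : ∑ k ∈ Finset.range n, thetaN d k (criticalProbI d) ≤ B * (n : ℝ) ^ (1 - c))
    {t : ℝ} (ht0 : 0 < t) (ht : t < criticalProbI d) :
    thetaN d n (criticalProbI d - t) ≤ thetaN d n (criticalProbI d) *
      Real.exp (-(t * (1 - (criticalProbI d : ℝ)) ^ (2 * d) * ((n : ℝ) ^ c / B))) := by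
  have hpc := criticalProbI_mem_Ioo hd
  refine (thetaN_subcritical_le' hd hn ht0 ht).trans (mul_le_mul_of_nonneg_left ?_ (thetaN_mem_Icc d n _).1)
  rw [Real.exp_le_exp, neg_le_neg_iff]
  have hc0 : 0 ≤ t * (1 - (criticalProbI d : ℝ)) ^ (2 * d) := (mul_pos ht0 (pow_pos (by linarith [hpc.2]) _)).le
  refine mul_le_mul_of_nonneg_left ?_ hc0
  have hS1 : 0 < ∑ k ∈ Finset.range n, thetaN d k (criticalProbI d) :=
    lt_of_lt_of_le zero_lt_one (one_le_sum_thetaN (by omega) hn _)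
  have hn0 : (0 : ℝ) < n := by exact_mod_cast hn
  -- `n^c / B ≤ n / S_n` since `S_n ≤ B n^{1-c}` and `n = n^c · n^{1−c}`
  rw [div_le_div_iff₀ hB hS1]
  calc (n : ℝ) ^ c * ∑ k ∈ Finset.range n, thetaN d k (criticalProbI d)
      ≤ (n : ℝ) ^ c * (B * (n : ℝ) ^ (1 - c)) := mul_le_mul_of_nonneg_left hS (Real.rpow_nonneg hn0.le c)
    _ = (n : ℝ) * B := by
        rw [mul_comm B, ← mul_assoc, ← Real.rpow_add hn0, show c + (1 - c) = 1 by ring, Real.rpow_one]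

end Summit.CriticalPhenomena.PercolationContinuityZ3.Theorems.FiniteSizeSharpness
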